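import Summits.Ventures.QEC.Census.CSSNormalFormSAT.CubeCover
import Summits.Ventures.QEC.Census.CSSNormalFormSAT.UnsatB8W8P01
import HarnessLib

/-!
# Cube cover of the normal-form instance `(16,5,8,8)`: tree, leaves, dispatch to the 2 leaf theorems (KERNEL-PLAN items 4/5)

`treeB8W8` is the split tree of census/type-02/css161/sat2/cubes/b8w8/tree.json; `leaves_treeB8W8` lists its leaves with unit literals
(kernel computation); `unsat_nf16_b8_w8_of_leaf` sends each leaf to its landed LRAT theorem. With `CubeTree.exists_leaf_allTrue` and
`false_of_unsat_units` (EncodeSoundSym.lean) this refutes every Boolean matrix in normal form for `(b,w) = (8,8)`. [folklore]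
-/

set_option autoImplicit false

namespace Summit.Ventures.QEC.Census.CSSNormalFormSAT

/-- The cube tree of instance `(16,5,8,8)`. (definition, data) -/
def treeB8W8 : CubeTree := (.node 2 (.leaf 0) (.leaf 1))

/-- Its split variables are `≥ 1`. [folklore] -/
theorem treeB8W8_wf : treeB8W8.WellFormed := by
  simp [treeB8W8, CubeTree.WellFormed]

/-- Its leaves with accumulated unit literals. [folklore] -/
theorem leaves_treeB8W8 : CubeTree.leaves treeB8W8 [] = [(0, [2]), (1, [-2])] := by rfl

/-- Every leaf's sub-instance is refuted in the kernel (dispatch to the landed `unsat_nf16_b8_w8_leaf*`). [folklore] -/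
theorem unsat_nf16_b8_w8_of_leaf : ∀ kl ∈ CubeTree.leaves treeB8W8 [],
    Sat.Fmla.proof (List.map (fun cl : List ℤ => cl.map Sat.Literal.ofInt) (NFEnc.cnf ⟨16, 5, 8, 8⟩ ++ kl.2.map fun l => [l])) Sat.Clause.nil := by
  intro kl hkl
  rw [leaves_treeB8W8] at hkl
  simp only [List.mem_cons, List.not_mem_nil, or_false] at hkl
  rcases hkl with h | h
  · subst h; exact unsat_nf16_b8_w8_leaf0
  · subst h; exact unsat_nf16_b8_w8_leaf1

end Summit.Ventures.QEC.Census.CSSNormalFormSAT
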